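import Summits.MatrixMultiplication.MatrixMultiplication.Theorems.SaturationLadderTransferLawRigidity
import Mathlib.Analysis.Convex.SpecificFunctions.Basic
import Mathlib.Analysis.Complex.ExponentialBounds
import HarnessLib

/-!
# Route `SaturationLadder` — the length floor is a CONE: closed under Kronecker sums of formats; it excludes every
subexponential witness below `log 4`
(decomp-mm lens 1 «grading / quantitative ladder», gen 28; route-free helper: imports NO `Theses` file)

The LENGTH FLOOR of a format `(a,b,c)` (gen 27, chain file 3: every X-perfect format obeys it, and it propagates
along exact transfers, `lengthFloor_transfer`; gen 28 file 1: along every transfer of small defect) is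
`F(a,b,c) :≡ b < a ∧ log 4 · b/(a−b) ≤ log((a+c)/b) + 1 − log 2`, i.e. `a + c ≥ (2/e)·b·4^{b/(a−b)}`.
Critic g27 r1 asked for its stability under `tight_add` (Kronecker sums of flat formats add exponent triples), so
that MIXED sums of X-perfect and near-square formats are priced too.  §§1–2: the gauge `g(x,b) = b·e^{λb/x}`
(`x = a − b`, `λ = log 4 ≥ 0`) is positively homogeneous and SUBADDITIVE — the perspective of the convex function
`u ↦ u·e^{λu}` (two-point convexity of `exp` plus Chebyshev's rearrangement `(u₁−u₂)(e^{λu₁}−e^{λu₂}) ≥ 0`);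
§3: hence `F` is closed under sums of formats (`lengthFloor_add`) and scalings; §4: the near-square family
`(a,b,a)`, `7b ≤ 2a`, and the far formats `(k,1,1)`, `k ≥ 2` (so also the level-two format) lie in `F`, the cube
does not (`F` prices LENGTH, the class invariant `J₃` of gen 27 prices onset); §5: in thin coordinates `(1,t,r)` the
floor reads `log 4 · t/(1−t) ≤ log((1+r)/t) + 1 − log 2`, and for every `0 < c < log 4` there is `t₀ < 1` beyond
which NO format in `F` has `r ≤ exp(c/(1−t))` (`floorClass_excludes_subexp_witness`): the closure of the tree's
flat catalogue under Kronecker sums and (near-)exact single-base transfers — all of it inside `F` — cannot supply the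
witnesses `SubexpSaturation` (25909) asks for below the in-class saturation constant `log 4`, which the proved
family `(k+1, k, 4^{k+2}k−k−1)` attains (`cwFamily_length_eq`).  Support module beneath stmt-MatrixMultiplication-25909;
closes no item; 0 sorry; no definitions; imports only BUILT modules.
[cite: CoppersmithWinograd1990, §8 (pp. 268–269); AlmanDuanVassilevskaWilliamsXuXuZhou2025, Thm. 3.2 and §3.4;
ChristandlLeGallLysikovZuiddam2020, Thm. 3.10; LottiRomani1983, §1 (p. 173)]
-/

set_option linter.dupNamespace false

noncomputable section

open scoped BigOperators

namespace Summit.MatrixMultiplication.MatrixMultiplication.Theorems.SaturationLadderLengthFloorCone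

open Literature.Computability.AlgebraicComplexity

/-! ## 1. Convexity core: `u ↦ u·e^{λu}` -/

/-- Two-point convexity of `u ↦ u·e^{λu}` on `[0,∞)` for `λ ≥ 0` (convexity of `exp` and Chebyshev's
rearrangement inequality `(u₁−u₂)(e^{λu₁}−e^{λu₂}) ≥ 0`). [folklore] -/
theorem mulExp_convex_combo {lam μ u₁ u₂ : ℝ} (hlam : 0 ≤ lam) (hμ0 : 0 ≤ μ) (hμ1 : μ ≤ 1)
    (hu₁ : 0 ≤ u₁) (hu₂ : 0 ≤ u₂) :
    (μ * u₁ + (1 - μ) * u₂) * Real.exp (lam * (μ * u₁ + (1 - μ) * u₂)) ≤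
      μ * (u₁ * Real.exp (lam * u₁)) + (1 - μ) * (u₂ * Real.exp (lam * u₂)) := by
  have hμ1' : 0 ≤ 1 - μ := by linarith
  have hconv := convexOn_exp.2 (Set.mem_univ (lam * u₁)) (Set.mem_univ (lam * u₂)) hμ0 hμ1' (by ring)
  simp only [smul_eq_mul] at hconv
  have e : lam * (μ * u₁ + (1 - μ) * u₂) = μ * (lam * u₁) + (1 - μ) * (lam * u₂) := by ring
  rw [e]
  have hū : 0 ≤ μ * u₁ + (1 - μ) * u₂ := by positivity
  have hcheb : 0 ≤ (u₁ - u₂) * (Real.exp (lam * u₁) - Real.exp (lam * u₂)) := by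
    rcases le_total u₁ u₂ with hle | hle
    · have : Real.exp (lam * u₁) ≤ Real.exp (lam * u₂) :=
        Real.exp_le_exp.2 (mul_le_mul_of_nonneg_left hle hlam)
      exact mul_nonneg_of_nonpos_of_nonpos (by linarith) (by linarith)
    · have : Real.exp (lam * u₂) ≤ Real.exp (lam * u₁) :=
        Real.exp_le_exp.2 (mul_le_mul_of_nonneg_left hle hlam)
      exact mul_nonneg (by linarith) (by linarith)
  have h1 : (μ * u₁ + (1 - μ) * u₂) * Real.exp (μ * (lam * u₁) + (1 - μ) * (lam * u₂)) ≤
      (μ * u₁ + (1 - μ) * u₂) * (μ * Real.exp (lam * u₁) + (1 - μ) * Real.exp (lam * u₂)) :=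
    mul_le_mul_of_nonneg_left hconv hū
  have key : μ * (u₁ * Real.exp (lam * u₁)) + (1 - μ) * (u₂ * Real.exp (lam * u₂)) -
      (μ * u₁ + (1 - μ) * u₂) * (μ * Real.exp (lam * u₁) + (1 - μ) * Real.exp (lam * u₂)) =
      μ * (1 - μ) * ((u₁ - u₂) * (Real.exp (lam * u₁) - Real.exp (lam * u₂))) := by ring
  have hpos := mul_nonneg (mul_nonneg hμ0 hμ1') hcheb
  linarith

/-! ## 2. The length gauge `g(x,b) = b·e^{λb/x}` is subadditive -/

/-- **Subadditivity of the length gauge**: `(b₁+b₂)·e^{λ(b₁+b₂)/(x₁+x₂)} ≤ b₁·e^{λb₁/x₁} + b₂·e^{λb₂/x₂}`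
(`x₁,x₂ > 0`, `b₁,b₂ ≥ 0`, `λ ≥ 0`): `g` is the perspective of the convex function `u ↦ u·e^{λu}`. [folklore] -/
theorem lengthGauge_subadditive {lam x₁ x₂ b₁ b₂ : ℝ} (hlam : 0 ≤ lam) (hx₁ : 0 < x₁) (hx₂ : 0 < x₂)
    (hb₁ : 0 ≤ b₁) (hb₂ : 0 ≤ b₂) :
    (b₁ + b₂) * Real.exp (lam * ((b₁ + b₂) / (x₁ + x₂))) ≤
      b₁ * Real.exp (lam * (b₁ / x₁)) + b₂ * Real.exp (lam * (b₂ / x₂)) := by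
  have hx : 0 < x₁ + x₂ := by linarith
  have hμ0 : 0 ≤ x₁ / (x₁ + x₂) := by positivity
  have hμ1 : x₁ / (x₁ + x₂) ≤ 1 := by rw [div_le_one hx]; linarith
  have core := mulExp_convex_combo (μ := x₁ / (x₁ + x₂)) (u₁ := b₁ / x₁) (u₂ := b₂ / x₂) hlam hμ0 hμ1
    (by positivity) (by positivity)
  have eū : x₁ / (x₁ + x₂) * (b₁ / x₁) + (1 - x₁ / (x₁ + x₂)) * (b₂ / x₂) = (b₁ + b₂) / (x₁ + x₂) := by
    field_simp
    ring
  rw [eū] at core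
  have := mul_le_mul_of_nonneg_left core hx.le
  have e0 : (x₁ + x₂) * ((b₁ + b₂) / (x₁ + x₂) * Real.exp (lam * ((b₁ + b₂) / (x₁ + x₂)))) =
      (b₁ + b₂) * Real.exp (lam * ((b₁ + b₂) / (x₁ + x₂))) := by
    field_simp
  have e1 : (x₁ + x₂) * (x₁ / (x₁ + x₂) * (b₁ / x₁ * Real.exp (lam * (b₁ / x₁))) +
      (1 - x₁ / (x₁ + x₂)) * (b₂ / x₂ * Real.exp (lam * (b₂ / x₂)))) =
      b₁ * Real.exp (lam * (b₁ / x₁)) + b₂ * Real.exp (lam * (b₂ / x₂)) := by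
    field_simp
    ring
  rw [e0, e1] at this
  exact this

/-! ## 3. The floor in exponential form; closure under sums and scalings -/

/-- Floor ⟹ exponential form: `log 4 · b/(a−b) ≤ log((a+c)/b) + 1 − log 2` ⟹ `2b·e^{log 4 · b/(a−b)} ≤ e·(a+c)`
(`0 < b`, `0 < a + c`). [folklore] -/
theorem expForm_of_floor {a b c : ℝ} (hb : 0 < b) (hac : 0 < a + c)
    (h : Real.log 4 * (b / (a - b)) ≤ Real.log ((a + c) / b) + 1 - Real.log 2) :
    2 * b * Real.exp (Real.log 4 * (b / (a - b))) ≤ Real.exp 1 * (a + c) := by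
  have hq : 0 < (a + c) / b := div_pos hac hb
  have h1 := Real.exp_le_exp.2 h
  have e : Real.exp (Real.log ((a + c) / b) + 1 - Real.log 2) = (a + c) / b * Real.exp 1 / 2 := by
    rw [Real.exp_sub, Real.exp_add, Real.exp_log hq, Real.exp_log (by norm_num : (0 : ℝ) < 2)]
  rw [e] at h1
  have h2 : 2 * b * ((a + c) / b * Real.exp 1 / 2) = Real.exp 1 * (a + c) := by
    field_simp
  calc 2 * b * Real.exp (Real.log 4 * (b / (a - b)))
      ≤ 2 * b * ((a + c) / b * Real.exp 1 / 2) := mul_le_mul_of_nonneg_left h1 (by linarith)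
    _ = Real.exp 1 * (a + c) := h2

/-- Exponential form ⟹ floor (`0 < b`, `0 < a + c`). [folklore] -/
theorem floor_of_expForm {a b c : ℝ} (hb : 0 < b) (hac : 0 < a + c)
    (h : 2 * b * Real.exp (Real.log 4 * (b / (a - b))) ≤ Real.exp 1 * (a + c)) :
    Real.log 4 * (b / (a - b)) ≤ Real.log ((a + c) / b) + 1 - Real.log 2 := by
  have hpos : 0 < 2 * b * Real.exp (Real.log 4 * (b / (a - b))) := by positivity
  have h1 := Real.log_le_log hpos h
  rw [Real.log_mul (by positivity) (Real.exp_pos _).ne', Real.log_mul (by norm_num) hb.ne', Real.log_exp,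
    Real.log_mul (Real.exp_pos _).ne' hac.ne', Real.log_exp, Real.log_div hac.ne' hb.ne'] at *
  linarith

/-- **The length floor is closed under Kronecker sums of formats** (exponent triples add, `tight_add`): over `ℝ`,
`F(a₁,b₁,c₁) ∧ F(a₂,b₂,c₂) ⟹ F(a₁+a₂, b₁+b₂, c₁+c₂)` for `0 < bᵢ < aᵢ`, `0 ≤ cᵢ`.  With gen 27
(`lengthFloor_transfer`, `xPerfect_lengthFloor`) and §4: the closure of the flat catalogue under sums and lawful
transfers lies in `F` (critic g27 r1). [cite: CoppersmithWinograd1990, §8 (pp. 268–269); AlmanDuanVassilevskaWilliamsXuXuZhou2025, §3.4] -/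
theorem lengthFloorReal_add {a₁ b₁ c₁ a₂ b₂ c₂ : ℝ} (hb₁ : 0 < b₁) (hb₂ : 0 < b₂) (hba₁ : b₁ < a₁)
    (hba₂ : b₂ < a₂) (hc₁ : 0 ≤ c₁) (hc₂ : 0 ≤ c₂)
    (h₁ : Real.log 4 * (b₁ / (a₁ - b₁)) ≤ Real.log ((a₁ + c₁) / b₁) + 1 - Real.log 2)
    (h₂ : Real.log 4 * (b₂ / (a₂ - b₂)) ≤ Real.log ((a₂ + c₂) / b₂) + 1 - Real.log 2) :
    Real.log 4 * ((b₁ + b₂) / ((a₁ + a₂) - (b₁ + b₂))) ≤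
      Real.log (((a₁ + a₂) + (c₁ + c₂)) / (b₁ + b₂)) + 1 - Real.log 2 := by
  have g₁ := expForm_of_floor hb₁ (by linarith) h₁
  have g₂ := expForm_of_floor hb₂ (by linarith) h₂
  have hlam : 0 ≤ Real.log 4 := Real.log_nonneg (by norm_num)
  have sub := lengthGauge_subadditive (b₁ := b₁) (b₂ := b₂) hlam (by linarith : 0 < a₁ - b₁)
    (by linarith : 0 < a₂ - b₂) hb₁.le hb₂.le
  have e : a₁ - b₁ + (a₂ - b₂) = (a₁ + a₂) - (b₁ + b₂) := by ring
  rw [e] at sub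
  refine floor_of_expForm (by linarith) (by linarith) ?_
  calc 2 * (b₁ + b₂) * Real.exp (Real.log 4 * ((b₁ + b₂) / ((a₁ + a₂) - (b₁ + b₂))))
      ≤ 2 * (b₁ * Real.exp (Real.log 4 * (b₁ / (a₁ - b₁))) + b₂ * Real.exp (Real.log 4 * (b₂ / (a₂ - b₂)))) := by
        nlinarith [sub]
    _ ≤ Real.exp 1 * ((a₁ + a₂) + (c₁ + c₂)) := by nlinarith [g₁, g₂]

/-- **Integer formats: the floor class `F` is closed under sums** (`1 ≤ bᵢ`): the typed version of «the length
floor is stable under `tight_add`» (critic g27 r1). [cite: CoppersmithWinograd1990, §8 (pp. 268–269); AlmanDuanVassilevskaWilliamsXuXuZhou2025, §3.4] -/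
theorem lengthFloor_add {a₁ b₁ c₁ a₂ b₂ c₂ : ℕ} (hb₁ : 1 ≤ b₁) (hb₂ : 1 ≤ b₂)
    (h₁ : b₁ < a₁ ∧ Real.log 4 * ((b₁ : ℝ) / ((a₁ : ℝ) - b₁)) ≤ Real.log (((a₁ : ℝ) + c₁) / b₁) + 1 - Real.log 2)
    (h₂ : b₂ < a₂ ∧ Real.log 4 * ((b₂ : ℝ) / ((a₂ : ℝ) - b₂)) ≤ Real.log (((a₂ : ℝ) + c₂) / b₂) + 1 - Real.log 2) :
    b₁ + b₂ < a₁ + a₂ ∧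
      Real.log 4 * (((b₁ + b₂ : ℕ) : ℝ) / (((a₁ + a₂ : ℕ) : ℝ) - ((b₁ + b₂ : ℕ) : ℝ))) ≤
        Real.log ((((a₁ + a₂ : ℕ) : ℝ) + ((c₁ + c₂ : ℕ) : ℝ)) / ((b₁ + b₂ : ℕ) : ℝ)) + 1 - Real.log 2 := by
  refine ⟨by omega, ?_⟩
  have hb₁R : (0 : ℝ) < b₁ := by exact_mod_cast hb₁
  have hb₂R : (0 : ℝ) < b₂ := by exact_mod_cast hb₂
  have hba₁ : (b₁ : ℝ) < a₁ := by exact_mod_cast h₁.1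
  have hba₂ : (b₂ : ℝ) < a₂ := by exact_mod_cast h₂.1
  have := lengthFloorReal_add hb₁R hb₂R hba₁ hba₂ (Nat.cast_nonneg c₁) (Nat.cast_nonneg c₂) h₁.2 h₂.2
  push_cast
  exact this

/-- `F` is invariant under scaling `(a,b,c) ↦ (na, nb, nc)`, `n ≥ 1` (Kronecker powers of one format). [folklore] -/
theorem lengthFloor_smul {a b c : ℕ} (n : ℕ) (hn : 1 ≤ n) (hb : 1 ≤ b)
    (h : b < a ∧ Real.log 4 * ((b : ℝ) / ((a : ℝ) - b)) ≤ Real.log (((a : ℝ) + c) / b) + 1 - Real.log 2) :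
    n * b < n * a ∧
      Real.log 4 * (((n * b : ℕ) : ℝ) / (((n * a : ℕ) : ℝ) - ((n * b : ℕ) : ℝ))) ≤
        Real.log ((((n * a : ℕ) : ℝ) + ((n * c : ℕ) : ℝ)) / ((n * b : ℕ) : ℝ)) + 1 - Real.log 2 := by
  refine ⟨Nat.mul_lt_mul_of_pos_left h.1 (by omega), ?_⟩
  have hnR : (0 : ℝ) < n := by exact_mod_cast hn
  have hbR : (0 : ℝ) < b := by exact_mod_cast hb
  have hbaR : (b : ℝ) < a := by exact_mod_cast h.1
  have e1 : ((n * b : ℕ) : ℝ) / (((n * a : ℕ) : ℝ) - ((n * b : ℕ) : ℝ)) = (b : ℝ) / ((a : ℝ) - b) := by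
    push_cast
    rw [← mul_sub, mul_div_mul_left _ _ hnR.ne']
  have e2 : (((n * a : ℕ) : ℝ) + ((n * c : ℕ) : ℝ)) / ((n * b : ℕ) : ℝ) = ((a : ℝ) + c) / b := by
    push_cast
    rw [← mul_add, mul_div_mul_left _ _ hnR.ne']
  rw [e1, e2]
  exact h.2

/-! ## 4. Membership: near-square and far formats are in `F`, the cube is not -/

/-- **Near-square formats are in `F`**: `(a,b,a)` with `b ≥ 1`, `7b ≤ 2a` (the landed flat family `flat_nearSquare`):
`b/(a−b) ≤ 2/5` and `(a+a)/b ≥ 7 ≥ 4`. [cite: LeGall2012, §1; LottiRomani1983, §1 (p. 173)] -/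
theorem lengthFloor_nearSquare {a b : ℕ} (hb : 1 ≤ b) (hab : 7 * b ≤ 2 * a) :
    b < a ∧ Real.log 4 * ((b : ℝ) / ((a : ℝ) - b)) ≤ Real.log (((a : ℝ) + a) / b) + 1 - Real.log 2 := by
  have hba : b < a := by omega
  refine ⟨hba, ?_⟩
  have hbR : (1 : ℝ) ≤ b := by exact_mod_cast hb
  have habR : 7 * (b : ℝ) ≤ 2 * a := by exact_mod_cast hab
  have hx : (0 : ℝ) < (a : ℝ) - b := by linarith
  have hκ : (b : ℝ) / ((a : ℝ) - b) ≤ 2 / 5 := by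
    rw [div_le_div_iff₀ hx (by norm_num)]; linarith
  have hlog4 : 0 ≤ Real.log 4 := Real.log_nonneg (by norm_num)
  have hq : (4 : ℝ) ≤ ((a : ℝ) + a) / b := by
    rw [le_div_iff₀ (by linarith)]; linarith
  have hlogq : Real.log 4 ≤ Real.log (((a : ℝ) + a) / b) := Real.log_le_log (by norm_num) hq
  have hl2 : Real.log 2 < 1 := by
    have := Real.log_lt_sub_one_of_pos (by norm_num : (0 : ℝ) < 2) (by norm_num); linarith
  nlinarith [mul_le_mul_of_nonneg_left hκ hlog4]

/-- **Far formats are in `F`**: `(k,1,1)`, `k ≥ 2` — in particular the LEVEL-TWO format `(2,1,1)`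
(`log 4 ≤ log 3 + 1 − log 2 ⟺ 8/3 ≤ e`): `F` prices length, not onset (onset is priced by the class invariant `J₃`
of gen 27, which `(2,1,1)` violates). [folklore] -/
theorem lengthFloor_far (k : ℕ) (hk : 2 ≤ k) :
    1 < k ∧ Real.log 4 * (((1 : ℕ) : ℝ) / ((k : ℝ) - (1 : ℕ))) ≤
      Real.log (((k : ℝ) + (1 : ℕ)) / (1 : ℕ)) + 1 - Real.log 2 := by
  refine ⟨by omega, ?_⟩
  have hkR : (2 : ℝ) ≤ k := by exact_mod_cast hk
  push_cast
  rw [div_one]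
  have hlog4 : 0 ≤ Real.log 4 := Real.log_nonneg (by norm_num)
  -- `log 4 · 1/(k−1) ≤ log 4`
  have h1 : Real.log 4 * (1 / ((k : ℝ) - 1)) ≤ Real.log 4 := by
    have : 1 / ((k : ℝ) - 1) ≤ 1 := by rw [div_le_one (by linarith)]; linarith
    nlinarith
  -- `log 4 ≤ log 3 + 1 − log 2`: `log (8/3) ≤ 1 = log e`
  have h83 : (8 : ℝ) / 3 ≤ Real.exp 1 := by
    have := Real.exp_one_gt_d9; linarith
  have hlog83 : Real.log (8 / 3) ≤ 1 := by
    have := Real.log_le_log (by norm_num) h83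
    rwa [Real.log_exp] at this
  have e83 : Real.log (8 / 3) = Real.log 4 + Real.log 2 - Real.log 3 := by
    rw [Real.log_div (by norm_num) (by norm_num), show (8 : ℝ) = 4 * 2 by norm_num,
      Real.log_mul (by norm_num) (by norm_num)]
  have h3 : Real.log 3 ≤ Real.log ((k : ℝ) + 1) := Real.log_le_log (by norm_num) (by linarith)
  linarith

/-- The cube `(b,b,b)` is not in `F` (`b < b` fails): `F` does not contain the summit's format — consistent with
`summit_iff_cube_flat` being out of reach of every in-class transfer. [folklore] -/
theorem not_lengthFloor_cube (b : ℕ) :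
    ¬ (b < b ∧ Real.log 4 * ((b : ℝ) / ((b : ℝ) - b)) ≤ Real.log (((b : ℝ) + b) / b) + 1 - Real.log 2) :=
  fun h => lt_irrefl b h.1

/-! ## 5. Thin coordinates: `F` supplies no subexponential witness below `log 4` -/

/-- **The floor class excludes every witness of `SubexpSaturation` below `log 4`.**  In thin coordinates `(1,t,r)`
the floor reads `log 4 · t/(1−t) ≤ log((1+r)/t) + 1 − log 2`; for every `0 < c < log 4` there is `t₀ < 1` such
that for all `t ∈ [t₀,1)` and `r > 0` obeying the floor, `r > exp(c/(1−t))`.  So no format in the closure of the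
flat catalogue under sums and lawful single-base transfers can serve as the pair `(t, r ≤ exp(c/(1−t)))` demanded by
the crux `SubexpSaturation` for `c < log 4`; the proved family `(k+1,k,4^{k+2}k−k−1)` shows `log 4` is attained
in-class (`cwFamily_length_eq`): the in-class saturation constant is exactly `log 4`.
[cite: CoppersmithWinograd1990, §8 (pp. 268–269); AlmanDuanVassilevskaWilliamsXuXuZhou2025, Thm. 3.2 and §3.4] -/
theorem floorClass_excludes_subexp_witness (c : ℝ) (hc : 0 < c) (hc4 : c < Real.log 4) :
    ∃ t₀ : ℝ, t₀ < 1 ∧ ∀ t r : ℝ, t₀ ≤ t → t < 1 → 0 < r →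
      Real.log 4 * (t / (1 - t)) ≤ Real.log ((1 + r) / t) + 1 - Real.log 2 →
        Real.exp (c / (1 - t)) < r := by
  set δ := Real.log 4 - c with hδ
  have hδ0 : 0 < δ := by rw [hδ]; linarith
  have hM : 0 < Real.log 8 + 1 := by
    have : 0 ≤ Real.log 8 := Real.log_nonneg (by norm_num); linarith
  set η := δ / (2 * (Real.log 8 + 1)) with hη
  have hη0 : 0 < η := by rw [hη]; positivity
  refine ⟨max (1 / 2) (1 - η), max_lt (by norm_num) (by linarith), ?_⟩
  intro t r ht0 ht1 hr hF
  have ht12 : 1 / 2 ≤ t := le_trans (le_max_left _ _) ht0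
  have htη : 1 - η ≤ t := le_trans (le_max_right _ _) ht0
  have hs : 0 < 1 - t := by linarith
  have ht : 0 < t := by linarith
  -- exponential form of the floor: `2t·exp(log 4 · t/(1−t)) ≤ e·(1+r)`
  have g := expForm_of_floor (a := 1) (b := t) (c := r) ht (by linarith) hF
  -- `log 4 · t/(1−t) = log 4/(1−t) − log 4`, so `exp(…) = exp(log 4/(1−t))/4`
  have e1 : Real.log 4 * (t / (1 - t)) = Real.log 4 / (1 - t) - Real.log 4 := by
    field_simp
    ring
  have e2 : Real.exp (Real.log 4 * (t / (1 - t))) = Real.exp (Real.log 4 / (1 - t)) / 4 := by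
    rw [e1, Real.exp_sub, Real.exp_log (by norm_num : (0 : ℝ) < 4)]
  rw [e2] at g
  -- split `log 4/(1−t) = δ/(1−t) + c/(1−t)`
  have e3 : Real.exp (Real.log 4 / (1 - t)) = Real.exp (δ / (1 - t)) * Real.exp (c / (1 - t)) := by
    rw [← Real.exp_add]; congr 1; rw [hδ]; field_simp; ring
  rw [e3] at g
  -- `δ/(1−t) ≥ 2(log 8 + 1) > log 8 + 1`, hence `exp(δ/(1−t)) > 8e`
  have hbig : Real.log 8 + 1 < δ / (1 - t) := by
    rw [lt_div_iff₀ hs]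
    have h1 : 1 - t ≤ η := by linarith
    have h2 : (Real.log 8 + 1) * (1 - t) ≤ (Real.log 8 + 1) * η := mul_le_mul_of_nonneg_left h1 hM.le
    have h3 : (Real.log 8 + 1) * η = δ / 2 := by rw [hη]; field_simp
    linarith
  have h8e : 8 * Real.exp 1 < Real.exp (δ / (1 - t)) := by
    have := Real.exp_lt_exp.2 hbig
    rwa [Real.exp_add, Real.exp_log (by norm_num : (0 : ℝ) < 8)] at this
  have hC : 1 ≤ Real.exp (c / (1 - t)) := Real.one_le_exp (by positivity)
  have he : 0 < Real.exp 1 := Real.exp_pos 1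
  -- `e(1+r) ≥ 2t·exp(δ/(1−t))·C/4 ≥ (1/4)·8e·C = 2eC`, so `1 + r > 2C ≥ C + 1`
  have hC0 : 0 < Real.exp (c / (1 - t)) := Real.exp_pos _
  nlinarith [mul_lt_mul_of_pos_right h8e hC0, mul_le_mul_of_nonneg_right ht12 (mul_pos (Real.exp_pos (δ / (1 - t))) hC0).le]

end Summit.MatrixMultiplication.MatrixMultiplication.Theorems.SaturationLadderLengthFloorCone

end
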